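import Literature.AlgebraicGeometry.Hu2025.Proofs.S04ModelV.DescentKernel
import HarnessLib

/-!
# Hu 2025 §4.2 — kernel COUNTERMODELS TO RENDERINGS of row 103: the in-text claim C22L173 in READING R1 (cofactors
# arbitrary) refuted on every two-block datum, plus Ex. 4.14 for reading R2 (non-vacuity); companion of `DescentKernel.lean` (row 103, file `Proofs/S04ModelV/RenderingCountermodels.lean`;
# typer of record res-type-042)

**HONEST FRAMING (D-0012/D-0089).** A kernel countermodel to OUR RENDERING R1 (`S04ModelV.C22L173`, res-type-044's
`IsDescentStep` with arbitrary cofactors `n_i`), NOT to the printed sentence: the printed «multi-homogeneous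
expression `f = Σ_i x_(u_i,v_i) 𝐧_i`» with bold `𝐧_i` (the paper's monomial letters) is the term-wise reading R2, under
which the claim is the theorem `C22L173_R2_holds`. The two files together say exactly which reading the sentence
p0022 l.173 / PDF p.49 L033 needs. The preprint [Hu2025] stays «under review»; nothing of it is asserted; AI proof is
weaker than expert review.

§1 (`isDescentStepR2_zero_wpBinomial`, `isParentOfR2_zero_wpBinomial`): Ex. 4.14 ‹chunk 4.13› as a theorem about
reading R2 — the zero expression `x_{t′}·x_t − x_t·x_{t′}` descends term-wise to the ℘-binomial (R2 is not vacuous;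
«allowed to be zero»). §2, GENERIC: `not_C22L173_of_two_blocks` — for every nontrivial commutative ring `k`, every `mono`
and every index datum with two ϱ-variables `x_t ≠ x_{t′}` in one block `F ∈ Φ` and two `x_s ≠ x_{s′}` in another block
`F′ ∈ Φ` (every platform instance `n ≥ 5`), `¬ C22L173 rel mono Φ`: with `B = x̄_{s′} x_s − x̄_s x_{s′}`, the R1-expression
`x_t·(x_{t′}) + x_{t′}·(−x_t + B)` has value `f = x_{t′} B ∈ ker^{mh} φ` (`r1Parent_mem_kerMH`), its R1-descendant
`g = x̄_t x_{t′} + x̄_{t′}(−x_t + B)` (`isDescentStep_r1`) carries in the block `F` the weight-`1` monomial `x̄_t x_{t′}` and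
the weight-`0` monomial `x̄_{t′} x̄_{s′} x_s` (`r1Child_eq`, `r1Child_not_isMultiHomogeneous`), so `g ∉ ker^{mh} φ`. §3: the
smallest instance (`k = ℤ`, `σ = Unit`, `T = Fin 4`, `𝔗 = Fin 2`) `not_C22L173_inst` and the universal closure
`not_C22L173`.
-/

noncomputable section

namespace Literature.AlgebraicGeometry.Hu2025.Statements.S04ModelV

open MvPolynomial

universe u v w x

section ExampleR2

variable {k : Type u} [CommRing k] {σ : Type v} {T : Type w} {𝔗 : Type x}

/-! ## §1 Example 4.14 ‹chunk 4.13› as a theorem about reading R2: the zero expression `x_{t′}x_t − x_t x_{t′}` descends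
to the ℘-binomial (non-vacuity of the term-wise descent relation, «allowed to be zero») -/

/-- **Hu 2025, Ex. 4.14 ‹chunk Ex. 4.13› for reading R2:** for two ϱ-variables `x_t, x_{t′}` of one block `F ∈ Φ`, the
term-wise expression `x_{t′}·(x_t) + x_t·(−x_{t′})` (value `0`) is a multi-homogeneous expression in `R_Φ` and descends in
one step at `F` to `x̄_{t′} x_t − x̄_t x_{t′}`, the ℘-binomial `wpBinomial mono t t′`: `IsDescentStepR2 Φ F 0 (wpBinomial t t′)`.
[cite: Hu2025, §4.2.2 Ex. 4.14 ‹chunk Ex. 4.13› (4.10) «x_(u′,v′)x_(u,v) − x_(u,v)x_(u′,v′) (which is zero as a binomial) descends to the ℘-binomial», chunk p0023 l.35–48, p.50 L022–L027 (unrefereed preprint arXiv:2507.21400v1 under adjudication, D-0012/D-0089 — kernel support on OUR typed renderings of row 103; nothing of the source asserted)] -/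
theorem isDescentStepR2_zero_wpBinomial [DecidableEq 𝔗] [DecidableEq σ] [DecidableEq T] (rel : T → 𝔗)
    (mono : T → (σ →₀ ℕ)) (Φ : Set 𝔗) {t t' : T} (hrel : rel t = rel t') (hΦ : rel t ∈ Φ) :
    IsDescentStepR2 (k := k) rel mono Φ (rel t) 0 (wpBinomial (k := k) (σ := σ) mono t t') := by
  have hX : ∀ d : T, rel d = rel t → (X (Sum.inr d) : ModelRing σ T k) ∈ RSub (k := k) rel Φ := by
    intro d hd
    unfold RSub
    rw [supported_eq_adjoin_X]
    refine Algebra.subset_adjoin ⟨Sum.inr d, Or.inr ⟨d, ?_, rfl⟩, rfl⟩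
    rw [Set.mem_preimage, hd]; exact hΦ
  have key : ∀ (a b : T) (c : k), rel a = rel t → rel b = rel t →
      rel a = rel t ∧ exprSummand (k := k) (σ := σ) (a, Finsupp.single (Sum.inr b) 1, c) ∈ RSub (k := k) rel Φ ∧
      ∀ G : 𝔗, IsWeightedHomogeneous (blockWeight rel G)
        (exprSummand (k := k) (σ := σ) (a, Finsupp.single (Sum.inr b) 1, c)) (if rel t = G then 2 else 0) := by
    intro a b c ha hb
    refine ⟨ha, ?_, ?_⟩
    · show rhoVar (k := k) (σ := σ) a * monomial (Finsupp.single (Sum.inr b) 1) c ∈ RSub (k := k) rel Φ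
      unfold rhoVar
      rw [← C_mul_X_eq_monomial, ← MvPolynomial.algebraMap_eq]
      exact Subalgebra.mul_mem _ (hX a ha)
        (Subalgebra.mul_mem _ (Subalgebra.algebraMap_mem _ c) (hX b hb))
    · intro G
      rw [exprSummand_eq]
      apply isWeightedHomogeneous_monomial
      dsimp only
      rw [map_add, weight_blockWeight_single, weight_blockWeight_single, ha, hb]
      split_ifs <;> rfl
  refine ⟨[(t', Finsupp.single (Sum.inr t) 1, 1), (t, Finsupp.single (Sum.inr t') 1, -1)], ?_, ?_, ?_⟩
  · -- a multi-homogeneous expression: block `F`, summands in `R_Φ`, common multidegree `2 e_F`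
    refine ⟨fun G => if rel t = G then 2 else 0, ?_⟩
    intro p hp
    simp only [List.mem_cons, List.not_mem_nil, or_false] at hp
    rcases hp with rfl | rfl
    · exact key t' t 1 hrel.symm rfl
    · exact key t t' (-1) rfl hrel.symm
  · -- the value of the expression is `0`
    symm
    simp only [List.map_cons, List.map_nil, List.sum_cons, List.sum_nil, add_zero, exprSummand_eq]
    rw [add_comm (Finsupp.single (Sum.inr t') 1) (Finsupp.single (Sum.inr t) 1), ← map_add, add_neg_cancel,
      map_zero]
  · -- the descended value is the ℘-binomial
    simp only [List.map_cons, List.map_nil, List.sum_cons, List.sum_nil, add_zero, exprSummandBar_eq]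
    rw [wpBinomial_eq, sub_eq_add_neg, ← map_neg]

/-- **`0` is a term-wise parent of every ℘-binomial of a block in play** (Ex. 4.14 for reading R2).
[cite: Hu2025, §4.2.2 Ex. 4.14 ‹chunk Ex. 4.13› (4.10) «x_(u′,v′)x_(u,v) − x_(u,v)x_(u′,v′) (which is zero as a binomial) descends to the ℘-binomial», chunk p0023 l.35–48, p.50 L022–L027 (unrefereed preprint arXiv:2507.21400v1 under adjudication, D-0012/D-0089 — kernel support on OUR typed renderings of row 103; nothing of the source asserted)] -/
theorem isParentOfR2_zero_wpBinomial [DecidableEq 𝔗] [DecidableEq σ] [DecidableEq T] (rel : T → 𝔗)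
    (mono : T → (σ →₀ ℕ)) (Φ : Set 𝔗) {t t' : T} (hrel : rel t = rel t') (hΦ : rel t ∈ Φ) :
    IsParentOfR2 (k := k) rel mono Φ 0 (wpBinomial (k := k) (σ := σ) mono t t') :=
  Relation.ReflTransGen.single ⟨rel t, isDescentStepR2_zero_wpBinomial rel mono Φ hrel hΦ⟩

end ExampleR2

/-! ## §2 Reading R1 of the claim C22L173: a GENERIC countermodel to the RENDERING (arbitrary cofactors)

Whenever the index data carry two ϱ-variables `x_t ≠ x_{t′}` of one block `F ∈ Φ` and two ϱ-variables `x_s ≠ x_{s′}` of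
ANOTHER block `F′ ∈ Φ` (every platform instance with `n ≥ 5` does), reading R1 of C22L173 fails, for EVERY nontrivial
commutative ring `k` and EVERY `mono`: with the ℘-binomial `B = x̄_{s′} x_s − x̄_s x_{s′}` of the block `F′`, the
R1-expression `x_t·(x_{t′}) + x_{t′}·(−x_t + B)` (second cofactor NOT a term) has the multi-homogeneous value
`f = x_{t′}·B ∈ ker^{mh} φ`, and its R1-descendant `g = x̄_t x_{t′} + x̄_{t′}(−x_t + B)` has `φ g = 0` but carries, in
the block `F`, the weight-`1` monomial `x̄_t x_{t′}` and the weight-`0` monomial `x̄_{t′} x̄_{s′} x_s` — it is not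
multi-homogeneous, so `g ∉ ker^{mh} φ`. Under reading R2 this expression is not admissible (`−x_t + B` is not a term). -/

section GenericR1

variable {k : Type u} [CommRing k] {σ : Type v} {T : Type w} {𝔗 : Type x}

/-- `monoR mono t` vanishes on ϱ-variables (it is supported on ϖ-variables).
[cite: Hu2025, §4.2.2 Def. 4.11–4.12 + claims C22L173/C23L25, chunks p0022 l.153–173 / p0023 l.5–26, pp. 49–50 (unrefereed preprint arXiv:2507.21400v1 under adjudication, D-0012/D-0089 — kernel support on OUR typed renderings of row 103; nothing of the source asserted)] -/
theorem monoR_apply_inr (mono : T → (σ →₀ ℕ)) (t t'' : T) : monoR mono t (Sum.inr t'' : σ ⊕ T) = 0 :=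
  Finsupp.mapDomain_notin_range _ _ (by rintro ⟨s, hs⟩; cases hs)

/-- `f ∈ ker^{mh} φ_Φ` (blocks of `t′` and of `s, s′` in play).
[cite: Hu2025, §4.2.2 Def. 4.11–4.12 + claims C22L173/C23L25, chunks p0022 l.153–173 / p0023 l.5–26, pp. 49–50 (unrefereed preprint arXiv:2507.21400v1 under adjudication, D-0012/D-0089 — kernel support on OUR typed renderings of row 103; nothing of the source asserted)] -/
theorem r1Parent_mem_kerMH [DecidableEq 𝔗] [DecidableEq σ] [DecidableEq T] (rel : T → 𝔗) (mono : T → (σ →₀ ℕ))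
    (Φ : Set 𝔗) {t' s s' : T} (ht' : rel t' ∈ Φ) (hss' : rel s = rel s') (hs : rel s ∈ Φ) :
    (rhoVar (k := k) (σ := σ) t' * wpBinomial (k := k) (σ := σ) mono s s') ∈ kerMH (k := k) rel mono Φ := by
  refine ⟨?_, ?_, ?_⟩
  · refine Subalgebra.mul_mem _ ?_ (wpBinomial_mem_RSub rel mono Φ hss' hs)
    unfold rhoVar RSub
    rw [supported_eq_adjoin_X]
    exact Algebra.subset_adjoin ⟨Sum.inr t', Or.inr ⟨t', ht', rfl⟩, rfl⟩
  · intro G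
    obtain ⟨d, hd⟩ := wpBinomial_isMultiHomogeneous (k := k) rel mono hss' G
    refine ⟨(if rel t' = G then 1 else 0) + d, IsWeightedHomogeneous.mul ?_ hd⟩
    unfold rhoVar
    rw [X]
    exact isWeightedHomogeneous_monomial _ _ _ (weight_blockWeight_single rel G t')
  · rw [map_mul, varphi_wpBinomial, mul_zero]

/-- `g` is an R1-descendant of `f` in one step at the block of `t, t′`, through `x_t·(x_{t′}) + x_{t′}·(−x_t + B)`.
[cite: Hu2025, §4.2.2 Def. 4.11–4.12 + claims C22L173/C23L25, chunks p0022 l.153–173 / p0023 l.5–26, pp. 49–50 (unrefereed preprint arXiv:2507.21400v1 under adjudication, D-0012/D-0089 — kernel support on OUR typed renderings of row 103; nothing of the source asserted)] -/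
theorem isDescentStep_r1 [DecidableEq 𝔗] [DecidableEq σ] [DecidableEq T] (rel : T → 𝔗) (mono : T → (σ →₀ ℕ))
    (Φ : Set 𝔗) {t t' s s' : T} (htt' : rel t = rel t') (ht' : rel t' ∈ Φ) (hss' : rel s = rel s') (hs : rel s ∈ Φ) :
    IsDescentStep (k := k) rel mono (rel t) (rhoVar (k := k) (σ := σ) t' * wpBinomial (k := k) (σ := σ) mono s s')
      (toModel (T := T) (img (k := k) mono t) * rhoVar (k := k) (σ := σ) t' +
      toModel (T := T) (img (k := k) mono t') * (-rhoVar (k := k) (σ := σ) t + wpBinomial (k := k) (σ := σ) mono s s')) := by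
  refine ⟨(r1Parent_mem_kerMH rel mono Φ ht' hss' hs).2.1,
    [(t, rhoVar (k := k) (σ := σ) t'), (t', -rhoVar (k := k) (σ := σ) t + wpBinomial (k := k) (σ := σ) mono s s')],
    ?_, ?_, ?_⟩
  · intro p hp
    simp only [List.mem_cons, List.not_mem_nil, or_false] at hp
    rcases hp with rfl | rfl
    · rfl
    · exact htt'.symm
  · simp only [List.map_cons, List.map_nil, List.sum_cons, List.sum_nil, add_zero]
    ring
  · simp only [List.map_cons, List.map_nil, List.sum_cons, List.sum_nil, add_zero]

/-- The four monomials of `g`: `g = x̄_t x_{t′} − x̄_{t′} x_t + (x̄_{t′} x̄_{s′} x_s − x̄_{t′} x̄_s x_{s′})`.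
[cite: Hu2025, §4.2.2 Def. 4.11–4.12 + claims C22L173/C23L25, chunks p0022 l.153–173 / p0023 l.5–26, pp. 49–50 (unrefereed preprint arXiv:2507.21400v1 under adjudication, D-0012/D-0089 — kernel support on OUR typed renderings of row 103; nothing of the source asserted)] -/
theorem r1Child_eq (mono : T → (σ →₀ ℕ)) (t t' s s' : T) :
    (toModel (T := T) (img (k := k) mono t) * rhoVar (k := k) (σ := σ) t' +
      toModel (T := T) (img (k := k) mono t') * (-rhoVar (k := k) (σ := σ) t + wpBinomial (k := k) (σ := σ) mono s s')) =
      monomial (monoR mono t + Finsupp.single (Sum.inr t') 1) 1 -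
        monomial (monoR mono t' + Finsupp.single (Sum.inr t) 1) 1 +
      (monomial (monoR mono t' + (monoR mono s' + Finsupp.single (Sum.inr s) 1)) 1 -
        monomial (monoR mono t' + (monoR mono s + Finsupp.single (Sum.inr s') 1)) 1) := by
  unfold rhoVar
  rw [wpBinomial_eq, toModel_img, toModel_img, X, X, mul_add, mul_neg, mul_sub, monomial_mul, monomial_mul,
    monomial_mul, monomial_mul, mul_one]
  abel

/-- `g` is NOT multi-homogeneous (hence `g ∉ ker^{mh} φ`), provided `t ≠ t′`, the blocks of `t` and `s` differ, and `k` is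
nontrivial.
[cite: Hu2025, §4.2.2 Def. 4.11–4.12 + claims C22L173/C23L25, chunks p0022 l.153–173 / p0023 l.5–26, pp. 49–50 (unrefereed preprint arXiv:2507.21400v1 under adjudication, D-0012/D-0089 — kernel support on OUR typed renderings of row 103; nothing of the source asserted)] -/
theorem r1Child_not_isMultiHomogeneous [DecidableEq 𝔗] [Nontrivial k] (rel : T → 𝔗) (mono : T → (σ →₀ ℕ))
    {t t' s s' : T} (htt' : rel t = rel t') (hne : t ≠ t') (hss' : rel s = rel s') (hsne : s ≠ s')
    (hF : rel s ≠ rel t) : ¬ IsMultiHomogeneous (k := k) (σ := σ) rel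
      (toModel (T := T) (img (k := k) mono t) * rhoVar (k := k) (σ := σ) t' +
      toModel (T := T) (img (k := k) mono t') * (-rhoVar (k := k) (σ := σ) t + wpBinomial (k := k) (σ := σ) mono s s')) := by
  classical
  -- names for the four exponents
  set n1 := monoR mono t + Finsupp.single (Sum.inr t' : σ ⊕ T) 1 with hn1
  set n2 := monoR mono t' + Finsupp.single (Sum.inr t : σ ⊕ T) 1 with hn2
  set n3 := monoR mono t' + (monoR mono s' + Finsupp.single (Sum.inr s : σ ⊕ T) 1) with hn3
  set n4 := monoR mono t' + (monoR mono s + Finsupp.single (Sum.inr s' : σ ⊕ T) 1) with hn4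
  have hst' : s ≠ t' := fun h => hF (by rw [h, ← htt'])
  have hs't' : s' ≠ t' := fun h => hF (by rw [hss', h, ← htt'])
  have hts : t ≠ s := fun h => hF (by rw [← h])
  -- values at the ϱ-variable `x_{t′}`: n1 ↦ 1, n2, n3, n4 ↦ 0; at `x_s`: n3 ↦ 1, n1, n2, n4 ↦ 0
  have e1 : n1 (Sum.inr t') = 1 := by simp [hn1, monoR_apply_inr]
  have e2 : n2 (Sum.inr t') = 0 := by simp [hn2, monoR_apply_inr, hne]
  have e3 : n3 (Sum.inr t') = 0 := by simp [hn3, monoR_apply_inr, hst']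
  have e4 : n4 (Sum.inr t') = 0 := by simp [hn4, monoR_apply_inr, hs't']
  have d1 : n1 (Sum.inr s) = 0 := by simp [hn1, monoR_apply_inr, hst'.symm]
  have d2 : n2 (Sum.inr s) = 0 := by simp [hn2, monoR_apply_inr, hts]
  have d3 : n3 (Sum.inr s) = 1 := by simp [hn3, monoR_apply_inr]
  have d4 : n4 (Sum.inr s) = 0 := by simp [hn4, monoR_apply_inr, hsne.symm]
  have h21 : n2 ≠ n1 := fun h => by have := DFunLike.congr_fun h (Sum.inr t'); rw [e2, e1] at this; exact zero_ne_one this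
  have h31 : n3 ≠ n1 := fun h => by have := DFunLike.congr_fun h (Sum.inr t'); rw [e3, e1] at this; exact zero_ne_one this
  have h41 : n4 ≠ n1 := fun h => by have := DFunLike.congr_fun h (Sum.inr t'); rw [e4, e1] at this; exact zero_ne_one this
  have h13 : n1 ≠ n3 := fun h => by have := DFunLike.congr_fun h (Sum.inr s); rw [d1, d3] at this; exact zero_ne_one this
  have h23 : n2 ≠ n3 := fun h => by have := DFunLike.congr_fun h (Sum.inr s); rw [d2, d3] at this; exact zero_ne_one this
  have h43 : n4 ≠ n3 := fun h => by have := DFunLike.congr_fun h (Sum.inr s); rw [d4, d3] at this; exact zero_ne_one this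
  have hg := r1Child_eq (k := k) mono t t' s s'
  rw [← hn1, ← hn2, ← hn3, ← hn4] at hg
  have c1 : coeff n1 (toModel (T := T) (img (k := k) mono t) * rhoVar (k := k) (σ := σ) t' + toModel (T := T) (img (k := k) mono t') * (-rhoVar (k := k) (σ := σ) t + wpBinomial (k := k) (σ := σ) mono s s')) = 1 := by
    rw [hg]; simp only [coeff_add, coeff_sub, coeff_monomial, if_neg h21, if_neg h31, if_neg h41]; norm_num
  have c3 : coeff n3 (toModel (T := T) (img (k := k) mono t) * rhoVar (k := k) (σ := σ) t' + toModel (T := T) (img (k := k) mono t') * (-rhoVar (k := k) (σ := σ) t + wpBinomial (k := k) (σ := σ) mono s s')) = 1 := by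
    rw [hg]; simp only [coeff_add, coeff_sub, coeff_monomial, if_neg h13, if_neg h23, if_neg h43]; norm_num
  intro hH
  obtain ⟨d, hd⟩ := hH (rel t)
  have w1 : Finsupp.weight (blockWeight rel (rel t)) n1 = d := hd (by rw [c1]; exact one_ne_zero)
  have w3 : Finsupp.weight (blockWeight rel (rel t)) n3 = d := hd (by rw [c3]; exact one_ne_zero)
  rw [hn1, map_add, weight_blockWeight_monoR, weight_blockWeight_single, ← htt', if_pos rfl] at w1
  rw [hn3, map_add, map_add, weight_blockWeight_monoR, weight_blockWeight_monoR, weight_blockWeight_single,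
    if_neg hF] at w3
  omega

/-- **Reading R1 of C22L173 fails on EVERY index datum with two blocks in play carrying two ϱ-variables each** (so on
every platform instance `n ≥ 5`), for every nontrivial commutative ring `k` and every `mono`: a countermodel to the
RENDERING R1 (res-type-044's `IsDescentStep`, cofactors arbitrary), NOT to the printed sentence — under the term-wise
reading R2 the claim is the theorem `C22L173_R2_holds`. Nothing here is a verdict on [Hu2025].
[cite: Hu2025, §4.2.2 Def. 4.11–4.12 + claims C22L173/C23L25, chunks p0022 l.153–173 / p0023 l.5–26, pp. 49–50 (unrefereed preprint arXiv:2507.21400v1 under adjudication, D-0012/D-0089 — kernel support on OUR typed renderings of row 103; nothing of the source asserted)] -/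
theorem not_C22L173_of_two_blocks [DecidableEq 𝔗] [DecidableEq σ] [DecidableEq T] [Nontrivial k] (rel : T → 𝔗)
    (mono : T → (σ →₀ ℕ)) (Φ : Set 𝔗) {t t' s s' : T} (htt' : rel t = rel t') (hne : t ≠ t') (ht : rel t ∈ Φ)
    (hss' : rel s = rel s') (hsne : s ≠ s') (hs : rel s ∈ Φ) (hF : rel s ≠ rel t) :
    ¬ C22L173 (k := k) (σ := σ) rel mono Φ := by
  intro h
  have ht' : rel t' ∈ Φ := htt' ▸ ht
  have hpar := Relation.ReflTransGen.single (r := fun f' g' : ModelRing σ T k =>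
      ∃ F : 𝔗, IsDescentStep (k := k) rel mono F f' g') ⟨rel t, isDescentStep_r1 (k := k) rel mono Φ htt' ht' hss' hs⟩
  have hg := (h _ _ hpar).mp (r1Parent_mem_kerMH rel mono Φ ht' hss' hs)
  exact r1Child_not_isMultiHomogeneous rel mono htt' hne hss' hsne hF hg.2.1

end GenericR1

/-! ## §3 The smallest instance and the universal closure -/

/-- **Reading R1 of C22L173 refuted at the smallest instance** (`k = ℤ`, one ϖ-variable, `T = Fin 4`, `𝔗 = Fin 2`,
`t₀, t₁ ↦ 0`, `t₂, t₃ ↦ 1`, `x̄_t = y`, `Φ = univ`), from `not_C22L173_of_two_blocks`.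
[cite: Hu2025, §4.2.2 Def. 4.11–4.12 + claims C22L173/C23L25, chunks p0022 l.153–173 / p0023 l.5–26, pp. 49–50 (unrefereed preprint arXiv:2507.21400v1 under adjudication, D-0012/D-0089 — kernel support on OUR typed renderings of row 103; nothing of the source asserted)] -/
theorem not_C22L173_inst :
    ¬ C22L173 (k := ℤ) (σ := Unit) (fun t : Fin 4 => if t.val < 2 then (0 : Fin 2) else 1)
      (fun _ : Fin 4 => Finsupp.single () 1) (Set.univ : Set (Fin 2)) :=
  not_C22L173_of_two_blocks (k := ℤ) (fun t : Fin 4 => if t.val < 2 then (0 : Fin 2) else 1)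
    (fun _ : Fin 4 => Finsupp.single () 1) Set.univ (t := 0) (t' := 1) (s := 2) (s' := 3)
    (by decide) (by decide) trivial (by decide) (by decide) trivial (by decide)

/-- **The universal closure of reading R1 of C22L173 is false** (from `not_C22L173_inst`).
[cite: Hu2025, §4.2.2 Def. 4.11–4.12 + claims C22L173/C23L25, chunks p0022 l.153–173 / p0023 l.5–26, pp. 49–50 (unrefereed preprint arXiv:2507.21400v1 under adjudication, D-0012/D-0089 — kernel support on OUR typed renderings of row 103; nothing of the source asserted)] -/
theorem not_C22L173 :
    ¬ ∀ (k : Type) [CommRing k] (σ T 𝔗 : Type) [DecidableEq 𝔗] (rel : T → 𝔗) (mono : T → (σ →₀ ℕ))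
        (Φ : Set 𝔗), C22L173 (k := k) (σ := σ) rel mono Φ :=
  fun h => not_C22L173_inst (h ℤ Unit (Fin 4) (Fin 2) _ _ Set.univ)

end Literature.AlgebraicGeometry.Hu2025.Statements.S04ModelV

end
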